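import Mathlib
import HarnessLib
import Literature.Probability.MarkovChains.MetropolisHastings
import Summits.Ventures.LatticeQCDFlow.Exactness.JarzynskiFinite
import Summits.Ventures.LatticeQCDFlow.Exactness.TemperedTransitions

/-!
# Crooks' pathwise reversal identity: forward protocols versus reverse protocols with adjoint kernels

HONEST FRAMING: exact (Metropolis-corrected) sampling algorithms for lattice gauge theory;
figures of merit are autocorrelation/cost numbers at stated couplings and volumes; no
continuum-physics claim.

Venture `LatticeQCDFlow` (cell pub-lqcd), topic `Exactness`; FANOUT row 13 (`eng-snf`: the
`latflow-snf` protocol engine, modules `snf.protocol.run_reverse` and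
`snf.estimators.bennett_acceptance_ratio / crooks_crossing`, test t14).  NEW WORK of the cell (an
elementary finite-sum proof); the printed counterparts are named only, nothing is cited as a
fact: G. E. Crooks, J. Stat. Phys. 90 (1998) 1481 and Phys. Rev. E 61 (2000) 2361 (the path-space
fluctuation theorem); C. H. Bennett, J. Comput. Phys. 22 (1976) 245 (acceptance-ratio estimator);
R. M. Neal, Statistics and Computing 6 (1996) 353 (adjoint = "mutually reversible" kernels).

## Content

A forward protocol on a finite configuration space: actions `S 0, …, S n`, and for each step
`k < n` a Markov kernel `P k` applied AFTER the switch `S k → S (k+1)` (the convention of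
`JarzynskiFinite.lean`: `work S x = Σ_k (S (k+1) (x k) − S k (x k))`).  The REVERSE protocol
starts in equilibrium at `S n`, applies at each level the ADJOINT kernel `Padj k`
(`MutuallyReversible (e^{-S (k+1)}) (P k) (Padj k)`: `e^{-S(k+1) a} P k a b = e^{-S(k+1) b} Padj k b a`
— for a sequential heat-bath sweep this is the sweep with its sub-steps in reverse order) and
then switches `S (k+1) → S k`.  Indexing reverse paths by FORWARD time, the reverse process has
path weight `gibbsLaw (S n) (x n) · downProb Padj x` (written out in every statement; no new
definition is introduced) and its work is `−work S x`.

* `crooks_pathwise` — `e^{-S 0 (x 0)} · Π_k P k (x k) (x (k+1)) · e^{-W(x)} = e^{-S n (x n)} · Π_k Padj k (x (k+1)) (x k)`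
  for EVERY path `x` (no summation): Crooks' microscopic reversibility.
* `sum_reversePathLaw` — the reverse path weights form a probability law (adjoint kernels
  row-stochastic).
* `crooks_expectation` — for every path functional `F`:
  `E_fwd[e^{-W} F] = (Z n / Z 0) · E_rev[F]`; with `F = φ ∘ W` this is the identity behind
  Bennett's acceptance-ratio estimator and the crossing of the forward / reverse work
  histograms at `W = ΔF` (`crooks_work_observable`).
* `reverse_jarzynski` — `E_rev[e^{+W}] = Z 0 / Z n`: the reverse evolutions estimate the
  inverse ratio (latflow-snf `run_reverse`; test t14).
The forward Jarzynski equality itself is `jarzynski` of `JarzynskiFinite.lean`; the palindromic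
(up-then-down) composition is `TemperedTransitions.lean`.
-/

namespace Summit.Ventures.LatticeQCDFlow.Exactness

open Finset
open Literature.Probability.MarkovChains

variable {X : Type*} [Fintype X]

/-! ## Crooks' pathwise identity -/

omit [Fintype X] in
/-- **Crooks' microscopic reversibility (pathwise).**  If at every step the forward kernel `P k`
and the reverse kernel `Padj k` are mutually reversible for the weight `e^{-S (k+1)}`, then for
EVERY path `x`:
`e^{-S 0 (x 0)} · transProb P x · e^{-work S x} = e^{-S n (x n)} · downProb Padj x`.
Proof: peel the first step; the switch factor `e^{-(S 1 x₀ - S 0 x₀)}` turns `e^{-S 0 x₀}` into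
`e^{-S 1 x₀}`, mutual reversibility moves the weight across the first move; induct. -/
theorem crooks_pathwise : ∀ {n : ℕ} (S : Fin (n + 1) → X → ℝ) (P Padj : Fin n → X → X → ℝ),
    (∀ k : Fin n, MutuallyReversible (fun a => Real.exp (-S k.succ a)) (P k) (Padj k)) →
    ∀ x : Fin (n + 1) → X,
      Real.exp (-S 0 (x 0)) * transProb P x * Real.exp (-work S x) =
        Real.exp (-S (Fin.last n) (x (Fin.last n))) * downProb Padj x
  | 0, S, P, Padj, _, x => by
    simp [transProb, work, downProb]
  | n + 1, S, P, Padj, hrev, x => by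
    have hx : x = Fin.cons (x 0) (Fin.tail x) := by simp [Fin.cons_self_tail]
    set x₀ := x 0 with hx₀
    set y : Fin (n + 1) → X := Fin.tail x with hy
    rw [hx]
    have ih := crooks_pathwise (n := n) (fun k => S k.succ) (fun k => P k.succ) (fun k => Padj k.succ)
      (fun k => hrev k.succ) y
    rw [transProb_cons, work_cons, downProb_cons]
    have hlast : (Fin.cons x₀ y : Fin (n + 2) → X) (Fin.last (n + 1)) = y (Fin.last n) := by
      rw [← Fin.succ_last, Fin.cons_succ]
    rw [hlast]
    have h0 : Real.exp (-S 1 x₀) * P 0 x₀ (y 0) = Real.exp (-S 1 (y 0)) * Padj 0 (y 0) x₀ :=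
      hrev 0 x₀ (y 0)
    simp only [Fin.succ_last, Fin.succ_zero_eq_one] at ih
    calc Real.exp (-S 0 x₀) * (P 0 x₀ (y 0) * transProb (fun k => P k.succ) y) *
          Real.exp (-(S 1 x₀ - S 0 x₀ + work (fun k => S k.succ) y))
        = (Real.exp (-S 0 x₀) * Real.exp (-(S 1 x₀ - S 0 x₀))) * P 0 x₀ (y 0) *
            (transProb (fun k => P k.succ) y * Real.exp (-work (fun k => S k.succ) y)) := by
          rw [neg_add, Real.exp_add]; ring
      _ = (Real.exp (-S 1 x₀) * P 0 x₀ (y 0)) *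
            (transProb (fun k => P k.succ) y * Real.exp (-work (fun k => S k.succ) y)) := by
          rw [← Real.exp_add]; ring_nf
      _ = Padj 0 (y 0) x₀ * (Real.exp (-S 1 (y 0)) * transProb (fun k => P k.succ) y *
            Real.exp (-work (fun k => S k.succ) y)) := by
          rw [h0]; ring
      _ = Padj 0 (y 0) x₀ * (Real.exp (-S (Fin.last (n + 1)) (y (Fin.last n))) *
            downProb (fun k => Padj k.succ) y) := by
          rw [ih]
      _ = Real.exp (-S (Fin.last (n + 1)) (y (Fin.last n))) *
            (Padj 0 (y 0) x₀ * downProb (fun i => Padj i.succ) y) := by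
          ring

/-! ## The reverse path law is a probability law -/

/-- If every adjoint kernel has unit row sums, the reverse path weights built on ANY terminal law
`μ` have the total mass of `μ`: `Σ_x μ (x n) · downProb Padj x = Σ_y μ y`. -/
theorem sum_terminal_downProb : ∀ {n : ℕ} (μ : X → ℝ) (Padj : Fin n → X → X → ℝ),
    (∀ k b, ∑ a, Padj k b a = 1) →
      ∑ x : Fin (n + 1) → X, μ (x (Fin.last n)) * downProb Padj x = ∑ y, μ y
  | 0, μ, Padj, _ => by
    rw [sum_path_zero]
    refine sum_congr rfl fun y _ => ?_
    simp [downProb]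
  | n + 1, μ, Padj, hrow => by
    have ih := sum_terminal_downProb (n := n) μ (fun k => Padj k.succ) (fun k b => hrow k.succ b)
    rw [sum_path_cons]
    have hsummand : ∀ (x₀ : X) (x : Fin (n + 1) → X),
        μ ((Fin.cons x₀ x : Fin (n + 2) → X) (Fin.last (n + 1))) *
            downProb Padj (Fin.cons x₀ x : Fin (n + 2) → X) =
          Padj 0 (x 0) x₀ * (μ (x (Fin.last n)) * downProb (fun i => Padj i.succ) x) := by
      intro x₀ x
      rw [downProb_cons, ← Fin.succ_last, Fin.cons_succ]
      ring
    simp_rw [hsummand]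
    rw [sum_comm]
    calc ∑ x : Fin (n + 1) → X, ∑ x₀, Padj 0 (x 0) x₀ *
            (μ (x (Fin.last n)) * downProb (fun i => Padj i.succ) x)
        = ∑ x : Fin (n + 1) → X, μ (x (Fin.last n)) * downProb (fun i => Padj i.succ) x := by
          refine sum_congr rfl fun x _ => ?_
          rw [← sum_mul, hrow 0 (x 0), one_mul]
      _ = ∑ y, μ y := ih

/-- The reverse path law `x ↦ gibbsLaw (S n) (x n) · downProb Padj x` (equilibrium start at the
target, adjoint moves `x (k+1) → x k`, indexed by forward time) is a probability law when the
adjoint kernels are row-stochastic. -/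
theorem sum_reversePathLaw {n : ℕ} [Nonempty X] (S : Fin (n + 1) → X → ℝ)
    (Padj : Fin n → X → X → ℝ) (hrow : ∀ k b, ∑ a, Padj k b a = 1) :
    ∑ x : Fin (n + 1) → X, gibbsLaw (S (Fin.last n)) (x (Fin.last n)) * downProb Padj x = 1 := by
  rw [sum_terminal_downProb (gibbsLaw (S (Fin.last n))) Padj hrow]
  have hZ : partitionFn (S (Fin.last n)) ≠ 0 :=
    (sum_pos (fun y _ => Real.exp_pos _) univ_nonempty).ne'
  simp only [gibbsLaw]
  rw [← sum_div, div_eq_one_iff_eq hZ, partitionFn]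

/-! ## Crooks' identity for expectations; Bennett; reverse Jarzynski -/

/-- **Crooks' fluctuation identity for path functionals.**  For every functional `F` of the path,
`Σ_x pathLaw_fwd x · e^{-W(x)} · F x = (Z n / Z 0) · Σ_x gibbsLaw (S n) (x n) · downProb Padj x · F x`:
forward expectations reweighted by `e^{-W}` are expectations of the reverse process (started in
equilibrium at the target, adjoint kernels), up to the constant `Z n / Z 0`. -/
theorem crooks_expectation {n : ℕ} [Nonempty X] (S : Fin (n + 1) → X → ℝ) (P Padj : Fin n → X → X → ℝ)
    (hrev : ∀ k : Fin n, MutuallyReversible (fun a => Real.exp (-S k.succ a)) (P k) (Padj k))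
    (F : (Fin (n + 1) → X) → ℝ) :
    ∑ x : Fin (n + 1) → X, pathLaw (gibbsLaw (S 0)) P x * Real.exp (-work S x) * F x =
      partitionFn (S (Fin.last n)) / partitionFn (S 0) *
        ∑ x : Fin (n + 1) → X, gibbsLaw (S (Fin.last n)) (x (Fin.last n)) * downProb Padj x * F x := by
  have hZ0 : partitionFn (S 0) ≠ 0 := (sum_pos (fun y _ => Real.exp_pos _) univ_nonempty).ne'
  have hZn : partitionFn (S (Fin.last n)) ≠ 0 :=
    (sum_pos (fun y _ => Real.exp_pos _) univ_nonempty).ne'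
  rw [mul_sum]
  refine sum_congr rfl fun x _ => ?_
  have h := crooks_pathwise S P Padj hrev x
  simp only [pathLaw, gibbsLaw]
  calc Real.exp (-S 0 (x 0)) / partitionFn (S 0) * transProb P x * Real.exp (-work S x) * F x
      = (Real.exp (-S 0 (x 0)) * transProb P x * Real.exp (-work S x)) * F x / partitionFn (S 0) := by
        ring
    _ = (Real.exp (-S (Fin.last n) (x (Fin.last n))) * downProb Padj x) * F x / partitionFn (S 0) := by
        rw [h]
    _ = partitionFn (S (Fin.last n)) / partitionFn (S 0) *
          (Real.exp (-S (Fin.last n) (x (Fin.last n))) / partitionFn (S (Fin.last n)) *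
            downProb Padj x * F x) := by
        field_simp

/-- **Work observables (Bennett / histogram crossing).**  For every function `φ` of the work,
`E_fwd[e^{-W} φ(W)] = (Z n / Z 0) · E_rev[φ(W)]`, where on the reverse side `W = work S x` is MINUS
the work performed by the reverse evolution.  With `φ = 1` this is Jarzynski's equality; with
`φ(w) = 1/(1 + e^{C - w})` it is the identity solved by Bennett's acceptance-ratio estimator; read
as densities it says the forward histogram of `W` and the reverse histogram of `−W_rev` cross at
`W = ΔF = -log (Z n / Z 0)`. -/
theorem crooks_work_observable {n : ℕ} [Nonempty X] (S : Fin (n + 1) → X → ℝ)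
    (P Padj : Fin n → X → X → ℝ)
    (hrev : ∀ k : Fin n, MutuallyReversible (fun a => Real.exp (-S k.succ a)) (P k) (Padj k))
    (φ : ℝ → ℝ) :
    ∑ x : Fin (n + 1) → X, pathLaw (gibbsLaw (S 0)) P x * Real.exp (-work S x) * φ (work S x) =
      partitionFn (S (Fin.last n)) / partitionFn (S 0) *
        ∑ x : Fin (n + 1) → X,
          gibbsLaw (S (Fin.last n)) (x (Fin.last n)) * downProb Padj x * φ (work S x) :=
  crooks_expectation S P Padj hrev fun x => φ (work S x)

/-- **Reverse Jarzynski equality.**  The reverse evolutions (equilibrium start at the target,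
adjoint kernels, switches `S (k+1) → S k`) perform the work `W_rev = -work S x` and satisfy
`E_rev[e^{-W_rev}] = Z 0 / Z n` — the forward kernels only need unit row sums. -/
theorem reverse_jarzynski {n : ℕ} [Nonempty X] (S : Fin (n + 1) → X → ℝ) (P Padj : Fin n → X → X → ℝ)
    (hrev : ∀ k : Fin n, MutuallyReversible (fun a => Real.exp (-S k.succ a)) (P k) (Padj k))
    (hrowP : ∀ k a, ∑ b, P k a b = 1) :
    ∑ x : Fin (n + 1) → X,
        gibbsLaw (S (Fin.last n)) (x (Fin.last n)) * downProb Padj x * Real.exp (work S x) =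
      partitionFn (S 0) / partitionFn (S (Fin.last n)) := by
  have hZ0 : partitionFn (S 0) ≠ 0 := (sum_pos (fun y _ => Real.exp_pos _) univ_nonempty).ne'
  have hZn : partitionFn (S (Fin.last n)) ≠ 0 :=
    (sum_pos (fun y _ => Real.exp_pos _) univ_nonempty).ne'
  -- Crooks with F = e^{+W}: the forward side collapses to the total mass of the forward path law
  have h := crooks_expectation S P Padj hrev fun x => Real.exp (work S x)
  have hfwd : ∑ x : Fin (n + 1) → X,
      pathLaw (gibbsLaw (S 0)) P x * Real.exp (-work S x) * Real.exp (work S x) = 1 := by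
    calc ∑ x : Fin (n + 1) → X,
          pathLaw (gibbsLaw (S 0)) P x * Real.exp (-work S x) * Real.exp (work S x)
        = ∑ x : Fin (n + 1) → X, pathLaw (gibbsLaw (S 0)) P x := by
          refine sum_congr rfl fun x _ => ?_
          rw [mul_assoc, ← Real.exp_add, neg_add_cancel, Real.exp_zero, mul_one]
      _ = ∑ x₀, gibbsLaw (S 0) x₀ := sum_pathLaw _ _ hrowP
      _ = 1 := by
          simp only [gibbsLaw]
          rw [← sum_div, div_eq_one_iff_eq hZ0, partitionFn]
  rw [hfwd] at h
  -- solve  1 = (Z n / Z 0) · E_rev[e^{W}]  for the reverse expectation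
  have := h.symm
  field_simp at this
  field_simp
  linarith [this]

end Summit.Ventures.LatticeQCDFlow.Exactness
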